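import Literature.AlgebraicGeometry.Movasati2016.PeriodMatrixRank
import Literature.AlgebraicGeometry.HodgeTheory.FermatLinearCycleGorensteinIdeal
import Literature.AlgebraicGeometry.HodgeTheory.CompleteIntersectionHodgeLocusCodim
import Literature.AlgebraicGeometry.DuqueFrancoVillaflor2025.JoinHilbertFunction
import Mathlib.GroupTheory.Perm.Sign
import HarnessLib

/-!
# Periods of linear cycles in the Fermat variety (Movasati–Villaflor 2018, Thm. 1) and the rank
# `binom(n/2+d, d) − (n/2+1)²` of their period matrix (Movasati 2017, Thm. 2)

H. Movasati, R. Villaflor Loyola, *Periods of linear algebraic cycles*, Pure Appl. Math. Q. 14 (2018) 563–577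
(arXiv:1705.00084) [MovasatiVillaflor2018]. The Fermat variety `X^d_n = {x_0^d + ⋯ + x_{n+1}^d = 0}`, `n` even,
contains the linear cycles (§1)
`ℙ^{n/2}_{a,b} : x_{b_0} − ζ_{2d}^{1+2a_1} x_{b_1} = x_{b_2} − ζ_{2d}^{1+2a_3} x_{b_3} = ⋯ = x_{b_n} − ζ_{2d}^{1+2a_{n+1}} x_{b_{n+1}} = 0`,
`ζ_{2d}` a primitive `2d`-th root of unity, `b` a permutation of `{0, 1, …, n+1}`, `0 ≤ a_i ≤ d − 1`.

* **Theorem 1** (p. 3): for `i_0 + ⋯ + i_{n+1} = (n/2+1)d − n − 2`,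
  `(2π√−1)^{−n/2} ∫_{ℙ^{n/2}_{a,b}} Residue( x^i Ω / (x_0^d + ⋯ + x_{n+1}^d)^{n/2+1} )`
  `= (sign(b)·(−1)^{n/2} / (d^{n/2+1}·(n/2)!)) · ζ_{2d}^{Σ_{e=0}^{n/2} (i_{b_{2e}}+1)·(1+2a_{2e+1})}`
  if `i_{b_{2e−2}} + i_{b_{2e−1}} = d − 2` for all `e = 1, …, n/2+1`, and `= 0` otherwise.
* **§5** (p. 7): `I_N`, `ρ_i := ∫_ℙ ω_i + ∫_ℙ̌ ω_i`, the matrix `[ρ_{i+j}]`, `i ∈ I_{(n/2)d−n−2}`, `j ∈ I_d`, and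
  **Proposition 1** (rank of `[ρ_{i+j}]`, by computer); **§6** (p. 8): "Knowing that `ker [ρ_{i+j}]` is the Zariski
  tangent space of the analytic scheme `V_{[Z_0]}` … Proposition 1 implies that `V_{[Z_0]}` is smooth and reduced".

H. Movasati, *Gauss–Manin connection in disguise: Noether–Lefschetz and Hodge loci*, Asian J. Math. 21 (2017)
[Movasati2017GMCD]: **Theorem 2** (p. 4): "Assume that `d ≥ 2 + 4/n`. There is a Zariski open neighborhood `U` of
`0 ∈ V` such that all the components of the Hodge locus intersecting `U` have codimension
`≥ binom(n/2+d, d) − (n/2+1)²`. The lower bound is obtained by the locus of hypersurfaces containing a linear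
projective space `ℙ^{n/2}`"; **§3.5** (p. 10, end of the proof): "It is enough to find complex numbers `x_k` such
that `rank([x_{i+j}])` is [`binom(n/2+d, d) − (n/2+1)²`]. Such numbers are the periods of the projective space
`ℙ^{n/2}` inside the Fermat variety … `x_k := ∫_{ℙ^{n/2}} ω_{g_k}`." The same identity is [Movasati2016Periods]
eq. (12nov2015-2016) after Thm. 7 (p. 9): "for projective spaces `Z = ℙ^{n/2} ⊂ X` …
`rank([p_{i+j}]) = binom(n/2+d, d) − (n/2+1)²`, see [GMCD-NL]", i.e. [Movasati2016Periods] Thm. 5 at the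
tangent level, and the `L` column of every census row.

J. Duque Franco, R. Villaflor Loyola, arXiv:2312.17222 [DuqueFrancoVillaflor2025Join], **Remark 7.1**
(eq. (eqAGfakelcFermat)): `J^{F,λ} = ⟨x_0 − c_0x_1, …, x_n − c_{n/2}x_{n+1}, x_0^{d−1}, …, x_{n+1}^{d−1}⟩` for the
class `λ` of a (fake) linear cycle; genuine linear cycles: "all `c_j` are `d`-th roots of `−1`"
(here `c_e = ζ^{1+2a_{2e+1}}`, `ζ^d = −1`). R. Villaflor Loyola [Villaflorloyola2021] Prop. 4.1 (proof):
`J^{F,λ}_k = ⟨x_0, x_2, …, x_n, x_1^{d−1}, …, x_{n+1}^{d−1}⟩_k` "after relabeling the variables", with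
`dim R^{F,λ}_d = binom(n/2+d, d) − (n/2+1)²` (eq. (des1), equality case).

## What this file PROVES (0 facts, 0 sorry) over ANY field `K`, for every even `n`, every `d`, every `ζ ∈ K`,
## every twist vector `a` and permutation `b`

* `linearCyclePeriod n d ζ a b i` — Theorem 1's period of `ℙ^{n/2}_{a,b}` against `ω_i` with the common constant
  `(−1)^{n/2}/(d^{n/2+1}(n/2)!)` dropped (it does not change the rank: `Movasati2016.rank_periodMatrix_mul`); this is
  VERBATIM the census schema's `Summit…HodgeLocus.Census.period` (REFEREE R2 exponent reading), so that the census
  matrix `ivhsMatrix n d ζ [(c, P_{a,b})]` is `Movasati2016.periodMatrix (n+2) d ((n/2)d−n−2) d (c · linearCyclePeriod …)`;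
* `linearCycleFunctional` — the `K`-linear functional on `K[x_0, …, x_{n+1}]` whose values on monomials ARE these
  periods (`linearCycleFunctional_monomial`): it is `sign(b)·ζ^{Σ_e (1+2a_{2e+1})}` times the inverse-system generator
  `ℓ_λ` of `FermatLinearCycleGorensteinIdeal.lean` (lit. DFV Rem. 7.1) transported along the pairing
  `x_{b_{2e}} ↔ x_{2e}`, `x_{b_{2e+1}} ↔ x_{2e+1}` (`pairEquiv`); it is concentrated in degree `σ = (n/2+1)(d−2)` and
  kills the monomials of `J^F = (x_e^{d−1})`;
* **`annIdeal_linearCycleFunctional`**: its annihilator (Villaflor's `J^{F,[ℙ_{a,b}]}`, Def. 2.1) is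
  `linearCycleIdeal = ⟨x_{b_{2e}} − ζ^{1+2a_{2e+1}} x_{b_{2e+1}} (e ≤ n/2), x_i^{d−1} (i ≤ n+1)⟩` (`ζ ≠ 0`, `d ≥ 2`);
* **`hilbert_linearCycleIdeal`**: `HF_{[ℙ_{a,b}]}(k) = ciHilbert [(d−1)^{n/2+1}] k = HF of K[y_0..y_{n/2}]/(y_j^{d−1})`
  ("`HF_λ = HF_{[ℙ^{n/2}]}`");
* **`rank_periodMatrix_linearCycle`** (MAIN): for `n` even with `n + 2 ≤ (n/2)·d` (i.e. `d ≥ 2 + 4/n`), `ζ ≠ 0` and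
  any coefficient `c ≠ 0`:
  **`rank [c·p_{i+j}(ℙ^{n/2}_{a,b})]_{i ∈ I_{(n/2)d−n−2}, j ∈ I_d} = binom(n/2+d, d) − (n/2+1)²`**
  — Theorem 2 of [Movasati2017GMCD] at the level of its proof (§3.5), for ALL `(n, d, a, b)` at once; the census
  files `HodgeLocusCensusPlaneRank{,6,8}.lean` are the instances `(n,d) = (4,4), (6,4), (8,4)`, `b = id`;
* **`rank_periodMatrix_comb`**: for every `K`-linear combination `δ = Σ_k c_k [ℙ_{a_k,b_k}]` (period vector
  `combPeriod` = §5's `ρ_i`, the census schema's `periodComb`; period functional `combFunctional = Σ_k c_k ℓ_{a_k,b_k}`):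
  **`rank [p_{i+j}(δ)] = dim_K S_d − dim_K Ann(Σ_k c_k ℓ_k)_d = HF_{J^{F,δ}}(d)`** — the rank the census certifies for a
  row `δ` IS the Hilbert function of the Voisin–Otwinowska ideal of `δ` in degree `d` (§6; Villaflor Def. 2.1/Prop. 2.1).

The transcendental inputs — Theorem 1 itself (an integral), `ker [p_{i+j}] = T_0V` (Movasati Thm. 6 / Villaflor
Prop. 2.1) — are cited, NOT formalised: everything here is algebra on the printed period formula.
-/

noncomputable section

open MvPolynomial Module Literature.RingTheory.MvPolynomial Literature.AlgebraicGeometry.Kloosterman2025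
  Literature.AlgebraicGeometry.HodgeTheory Literature.AlgebraicGeometry.Movasati2016

attribute [local instance] MvPolynomial.gradedAlgebra

namespace Literature.AlgebraicGeometry.MovasatiVillaflor2018

variable {K : Type*} [Field K]

/-! ## Theorem 1: the period formula -/

/-- **MV18 Theorem 1**, normalised: the period `p_i(ℙ^{n/2}_{a,b})` of the linear cycle `ℙ^{n/2}_{a,b}`
(`x_{b(2e)} = ζ^{1+2a_{2e+1}} x_{b(2e+1)}`, `e = 0..n/2`) of the Fermat variety `X^d_n` against the monomial form
`ω_i`, with the common factor `(−1)^{n/2}/(d^{n/2+1}(n/2)!)` dropped: `sign(b)·ζ^{Σ_e (i_{b(2e)}+1)(1+2a_{2e+1})}` if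
`i_{b(2e)} + i_{b(2e+1)} = d − 2` for every `e`, else `0`. Verbatim the census schema's `Census.period`.
[cite: MovasatiVillaflor2018, Theorem 1] -/
def linearCyclePeriod (n d : ℕ) (ζ : K) (a : Fin (n+2) → ℕ) (b : Equiv.Perm (Fin (n+2)))
    (i : Fin (n+2) → ℕ) : K :=
  if ∀ e : Fin (n/2+1), i (b ⟨2*e, by omega⟩) + i (b ⟨2*e+1, by omega⟩) = d-2 then
    (Equiv.Perm.sign b : ℤ) *
      ζ ^ (∑ e : Fin (n/2+1), (i (b ⟨2*e, by omega⟩) + 1) * (1 + 2 * a ⟨2*e+1, by omega⟩))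
  else 0

/-- The pairing of the coordinates used by `ℙ^{n/2}_{a,b}` before the permutation `b`:
`Sum.inl e ↦ 2e`, `Sum.inr e ↦ 2e+1` (`n` even: a bijection `Fin (n/2+1) ⊕ Fin (n/2+1) ≃ Fin (n+2)`).
[cite: MovasatiVillaflor2018, §1] -/
def pairEquiv (n : ℕ) (hn : Even n) : Fin (n/2+1) ⊕ Fin (n/2+1) ≃ Fin (n+2) where
  toFun := Sum.elim (fun e => ⟨2*e, by omega⟩) (fun e => ⟨2*e+1, by omega⟩)
  invFun x := if x.1 % 2 = 0 then Sum.inl ⟨x.1/2, by obtain ⟨r, hr⟩ := hn; omega⟩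
    else Sum.inr ⟨x.1/2, by obtain ⟨r, hr⟩ := hn; omega⟩
  left_inv := by
    rintro (e | e)
    · have h : (2 * (e : ℕ)) % 2 = 0 := by omega
      simp only [Sum.elim_inl, h, ↓reduceIte, Sum.inl.injEq]
      ext
      simp only
      omega
    · have h : ¬ (2 * (e : ℕ) + 1) % 2 = 0 := by omega
      simp only [Sum.elim_inr, h, ↓reduceIte, Sum.inr.injEq]
      ext
      simp only
      omega
  right_inv := by
    intro x
    by_cases h : x.1 % 2 = 0
    · simp only [h, ↓reduceIte, Sum.elim_inl]
      ext
      simp only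
      omega
    · simp only [h, ↓reduceIte, Sum.elim_inr]
      ext
      simp only
      omega

/-- `pairEquiv (inl e) = 2e`. [cite: MovasatiVillaflor2018, §1] -/
@[simp] theorem pairEquiv_inl {n : ℕ} (hn : Even n) (e : Fin (n/2+1)) :
    pairEquiv n hn (Sum.inl e) = ⟨2*e, by omega⟩ := rfl

/-- `pairEquiv (inr e) = 2e+1`. [cite: MovasatiVillaflor2018, §1] -/
@[simp] theorem pairEquiv_inr {n : ℕ} (hn : Even n) (e : Fin (n/2+1)) :
    pairEquiv n hn (Sum.inr e) = ⟨2*e+1, by omega⟩ := rfl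

/-- The twists `c_e = ζ^{1+2a_{2e+1}}` of `ℙ^{n/2}_{a,b}` (its `e`-th equation is `x_{b(2e)} = c_e x_{b(2e+1)}`).
[cite: MovasatiVillaflor2018, §1] -/
def twist (n : ℕ) (ζ : K) (a : Fin (n+2) → ℕ) (e : Fin (n/2+1)) : K := ζ ^ (1 + 2 * a ⟨2*e+1, by omega⟩)

/-- **The period functional of `ℙ^{n/2}_{a,b}`**: `sign(b)·ζ^{Σ_e (1+2a_{2e+1})}` times the inverse-system generator
`ℓ_λ(g) = coeff_{∏ y^{d−2}} g(x_{2e} ↦ c_e y_e, x_{2e+1} ↦ y_e)` of DFV Rem. 7.1 (tree `fermatLinearCycleFunctional`),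
transported along `x_{b(2e)} ↦ x_{2e}`, `x_{b(2e+1)} ↦ x_{2e+1}`. Its values on monomials are the periods of
Theorem 1 (`linearCycleFunctional_monomial`); its graded annihilator is Villaflor's `J^{F,[ℙ_{a,b}]}` (Def. 2.1).
[cite: MovasatiVillaflor2018, Theorem 1] [cite: DuqueFrancoVillaflor2025Join, Remark 7.1]
[cite: Villaflorloyola2021, Definition 2.1] -/
def linearCycleFunctional (n d : ℕ) (ζ : K) (a : Fin (n+2) → ℕ) (b : Equiv.Perm (Fin (n+2))) (hn : Even n) :
    MvPolynomial (Fin (n+2)) K →ₗ[K] K :=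
  (((Equiv.Perm.sign b : ℤ) : K) * ζ ^ (∑ e : Fin (n/2+1), (1 + 2 * a ⟨2*e+1, by omega⟩))) •
    (fermatLinearCycleFunctional (twist n ζ a) (d-1) ∘ₗ
      (rename ((pairEquiv n hn).trans b).symm :
        MvPolynomial (Fin (n+2)) K →ₐ[K] MvPolynomial (Fin (n/2+1) ⊕ Fin (n/2+1)) K).toLinearMap)

/-- **`J^{F,[ℙ_{a,b}]}`**: the ideal `⟨x_{b(2e)} − ζ^{1+2a_{2e+1}} x_{b(2e+1)} (e = 0..n/2), x_i^{d−1} (i = 0..n+1)⟩`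
(DFV eq. (eqAGfakelcFermat) in the coordinates of `ℙ_{a,b}`; Villaflor: "`⟨x_0, x_2, …, x_n, x_1^{d−1}, …, x_{n+1}^{d−1}⟩`
after relabeling the variables"). [cite: DuqueFrancoVillaflor2025Join, Remark 7.1] [cite: Villaflorloyola2021, Proposition 4.1] -/
def linearCycleIdeal (n d : ℕ) (ζ : K) (a : Fin (n+2) → ℕ) (b : Equiv.Perm (Fin (n+2))) :
    Ideal (MvPolynomial (Fin (n+2)) K) :=
  Ideal.span ((Set.range fun e : Fin (n/2+1) =>
      (X (b ⟨2*e, by omega⟩) : MvPolynomial (Fin (n+2)) K) - C (twist n ζ a e) * X (b ⟨2*e+1, by omega⟩)) ∪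
    Set.range fun i : Fin (n+2) => (X i : MvPolynomial (Fin (n+2)) K) ^ (d - 1))

variable {n d : ℕ} (ζ : K) (a : Fin (n+2) → ℕ) (b : Equiv.Perm (Fin (n+2)))

/-! ## Transport of ideals along a relabeling of the variables -/

/-- For a bijection `θ` of variable sets, `I.map (rename θ) = I.comap (rename θ⁻¹)`. [folklore] -/
private theorem map_rename_eq_comap_rename_symm {σ σ' : Type*} (θ : σ ≃ σ') (I : Ideal (MvPolynomial σ K)) :
    I.map (rename θ : MvPolynomial σ K →ₐ[K] MvPolynomial σ' K) =
      I.comap (rename θ.symm : MvPolynomial σ' K →ₐ[K] MvPolynomial σ K) := by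
  apply le_antisymm
  · refine Ideal.map_le_iff_le_comap.mpr fun g hg => ?_
    rw [Ideal.mem_comap, Ideal.mem_comap, rename_rename, Equiv.symm_comp_self, rename_id, AlgHom.id_apply]
    exact hg
  · intro q hq
    rw [Ideal.mem_comap] at hq
    have h : rename θ (rename θ.symm q) = q := by
      rw [rename_rename, Equiv.self_comp_symm, rename_id, AlgHom.id_apply]
    rw [← h]
    exact Ideal.mem_map_of_mem _ hq

/-- **The Hilbert function does not see a relabeling of the variables**: `HF_{I.map (rename θ)} = HF_I` for a
bijection `θ` (Villaflor: "After relabeling the variables we can assume `x^α = x_1^{d−2}x_3^{d−2}⋯x_{n+1}^{d−2}`").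
[cite: Villaflorloyola2021, Proposition 4.1] -/
theorem hilbert_map_rename_equiv {σ σ' : Type*} [Finite σ] [Finite σ'] (θ : σ ≃ σ')
    (I : Ideal (MvPolynomial σ K)) (k : ℕ) :
    finrank K (homogeneousSubmodule σ' K k) -
        finrank K (idealDegree (I.map (rename θ : MvPolynomial σ K →ₐ[K] MvPolynomial σ' K)) k) =
      finrank K (homogeneousSubmodule σ K k) - finrank K (idealDegree I k) := by
  let φ : MvPolynomial σ K →ₗ[K] MvPolynomial σ' K :=
    (rename θ : MvPolynomial σ K →ₐ[K] MvPolynomial σ' K).toLinearMap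
  have hφ : ∀ p, φ p = rename θ p := fun p => rfl
  have hinj : Function.Injective φ := rename_injective _ θ.injective
  have hback : ∀ q : MvPolynomial σ' K, rename θ (rename θ.symm q) = q := fun q => by
    rw [rename_rename, Equiv.self_comp_symm, rename_id, AlgHom.id_apply]
  have h1 : (homogeneousSubmodule σ K k).map φ = homogeneousSubmodule σ' K k := by
    apply le_antisymm
    · rintro _ ⟨p, hp, rfl⟩
      exact (mem_homogeneousSubmodule _ _).mpr (((mem_homogeneousSubmodule _ _).mp hp).rename_isHomogeneous)
    · intro q hq
      refine ⟨rename θ.symm q, (mem_homogeneousSubmodule _ _).mpr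
        (((mem_homogeneousSubmodule _ _).mp hq).rename_isHomogeneous), ?_⟩
      rw [hφ, hback]
  have h2 : (idealDegree I k).map φ =
      idealDegree (I.map (rename θ : MvPolynomial σ K →ₐ[K] MvPolynomial σ' K)) k := by
    apply le_antisymm
    · rintro _ ⟨p, hp, rfl⟩
      have hp' := (mem_idealDegree (I := I)).mp hp
      exact mem_idealDegree.mpr ⟨Ideal.mem_map_of_mem _ hp'.1, hp'.2.rename_isHomogeneous⟩
    · intro q hq
      rw [mem_idealDegree, map_rename_eq_comap_rename_symm, Ideal.mem_comap] at hq
      refine ⟨rename θ.symm q, mem_idealDegree.mpr ⟨hq.1, hq.2.rename_isHomogeneous⟩, ?_⟩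
      rw [hφ, hback]
  rw [← h1, ← h2, LinearEquiv.finrank_eq (Submodule.equivMapOfInjective φ hinj _),
    LinearEquiv.finrank_eq (Submodule.equivMapOfInjective φ hinj _)]

/-- The annihilator of a functional pulled back along a surjective algebra map is the pull-back of the annihilator.
[cite: Kloosterman2025, Lemma 2.1] -/
theorem annIdeal_comp_of_surjective {A B : Type*} [CommRing A] [CommRing B] [Algebra K A] [Algebra K B]
    (φ : A →ₐ[K] B) (hφ : Function.Surjective φ) (ℓ : B →ₗ[K] K) :
    annIdeal (ℓ ∘ₗ φ.toLinearMap) = (annIdeal ℓ).comap φ := by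
  ext g
  rw [mem_annIdeal_iff, Ideal.mem_comap, mem_annIdeal_iff]
  constructor
  · intro h h'
    obtain ⟨h₀, rfl⟩ := hφ h'
    have := h h₀
    rwa [LinearMap.comp_apply, AlgHom.toLinearMap_apply, map_mul] at this
  · intro h h₀
    rw [LinearMap.comp_apply, AlgHom.toLinearMap_apply, map_mul]
    exact h _

/-- The annihilator does not see a non-zero scalar. [cite: Kloosterman2025, Lemma 2.1] -/
theorem annIdeal_smul {A : Type*} [CommRing A] [Algebra K A] (ℓ : A →ₗ[K] K) {c : K} (hc : c ≠ 0) :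
    annIdeal (c • ℓ) = annIdeal ℓ := by
  ext g
  simp only [mem_annIdeal_iff, LinearMap.smul_apply, smul_eq_mul, mul_eq_zero, hc, false_or]

/-! ## The restriction `x_{2e} ↦ c_e y_e`, `x_{2e+1} ↦ y_e` on monomials -/

/-- `ℓ_λ` on a monomial: `coeff_{∏ y^{e'−1}} ((∏_j c_j^{s(2j)}) · y^{(s(2j)+s(2j+1))_j})`, i.e. `∏_j c_j^{s(2j)}` if every pair
of exponents sums to `e' − 1` and `0` otherwise. [cite: DuqueFrancoVillaflor2025Join, Remark 7.1] -/
theorem fermatLinearCycleFunctional_monomial {τ : Type*} [Fintype τ] [DecidableEq τ] (c : τ → K) (e' : ℕ)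
    (s : τ ⊕ τ →₀ ℕ) (r : K) :
    fermatLinearCycleFunctional c e' (monomial s r) =
      if ∀ j, s (Sum.inl j) + s (Sum.inr j) = e' - 1 then r * ∏ j, c j ^ s (Sum.inl j) else 0 := by
  have hsub : fermatLinearCycleSubst c (monomial s r) =
      monomial (Finsupp.equivFunOnFinite.symm fun j => s (Sum.inl j) + s (Sum.inr j))
        (r * ∏ j, c j ^ s (Sum.inl j)) := by
    rw [fermatLinearCycleSubst, aeval_monomial, algebraMap_eq, Finsupp.prod_fintype _ _ (fun i => pow_zero _),
      Fintype.prod_sum_type, monomial_eq, Finsupp.prod_fintype _ _ (fun i => pow_zero _), C_mul]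
    simp only [Sum.elim_inl, Sum.elim_inr, Finsupp.coe_equivFunOnFinite_symm, mul_pow, pow_add,
      Finset.prod_mul_distrib, ← C_pow]
    rw [← map_prod C]
    ring
  rw [fermatLinearCycleFunctional_apply, hsub, coeff_monomial]
  have hiff : (Finsupp.equivFunOnFinite.symm fun j => s (Sum.inl j) + s (Sum.inr j)) = fermatSocleExponent τ e' ↔
      ∀ j, s (Sum.inl j) + s (Sum.inr j) = e' - 1 := by
    rw [Finsupp.ext_iff]
    simp only [Finsupp.coe_equivFunOnFinite_symm, fermatSocleExponent_apply]
  by_cases h : ∀ j, s (Sum.inl j) + s (Sum.inr j) = e' - 1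
  · rw [if_pos (hiff.mpr h), if_pos h]
  · rw [if_neg (fun h' => h (hiff.mp h')), if_neg h]

/-! ## The period functional: values on monomials (Theorem 1), degree, annihilator -/

/-- **The values of the period functional on monomials are the periods of Theorem 1**:
`ℓ_{a,b}(r x^s) = r · p_s(ℙ^{n/2}_{a,b})`. [cite: MovasatiVillaflor2018, Theorem 1]
[cite: DuqueFrancoVillaflor2025Join, Remark 7.1] -/
theorem linearCycleFunctional_monomial (hn : Even n) (s : Fin (n+2) →₀ ℕ) (r : K) :
    linearCycleFunctional n d ζ a b hn (monomial s r) = r * linearCyclePeriod n d ζ a b ⇑s := by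
  classical
  rw [linearCycleFunctional, LinearMap.smul_apply, LinearMap.comp_apply, AlgHom.toLinearMap_apply,
    rename_monomial, fermatLinearCycleFunctional_monomial, linearCyclePeriod]
  have hcoord : ∀ j : Fin (n/2+1),
      (Finsupp.mapDomain (((pairEquiv n hn).trans b).symm) s) (Sum.inl j) = s (b ⟨2*j, by omega⟩) ∧
      (Finsupp.mapDomain (((pairEquiv n hn).trans b).symm) s) (Sum.inr j) = s (b ⟨2*j+1, by omega⟩) := by
    intro j
    constructor
    · rw [Finsupp.mapDomain_equiv_apply, Equiv.symm_symm, Equiv.trans_apply, pairEquiv_inl]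
    · rw [Finsupp.mapDomain_equiv_apply, Equiv.symm_symm, Equiv.trans_apply, pairEquiv_inr]
  simp only [(hcoord _).1, (hcoord _).2, show d - 1 - 1 = d - 2 by omega]
  by_cases h : ∀ e : Fin (n/2+1), s (b ⟨2*e, by omega⟩) + s (b ⟨2*e+1, by omega⟩) = d - 2
  · rw [if_pos h, if_pos h, smul_eq_mul]
    simp only [twist, ← pow_mul, Finset.prod_pow_eq_pow_sum]
    rw [show (∑ e : Fin (n/2+1), (s (b ⟨2*e, by omega⟩) + 1) * (1 + 2 * a ⟨2*e+1, by omega⟩)) =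
        (∑ e : Fin (n/2+1), (1 + 2 * a ⟨2*e+1, by omega⟩)) +
          ∑ e : Fin (n/2+1), (1 + 2 * a ⟨2*e+1, by omega⟩) * s (b ⟨2*e, by omega⟩) from by
      rw [← Finset.sum_add_distrib]; exact Finset.sum_congr rfl fun e _ => by ring, pow_add]
    ring
  · rw [if_neg h, if_neg h, smul_zero, mul_zero]

/-- `ℓ_{a,b}(x^i) = p_i(ℙ^{n/2}_{a,b})`: the period vector of the period functional IS Theorem 1's vector.
[cite: MovasatiVillaflor2018, Theorem 1] -/
theorem periodVector_linearCycleFunctional (hn : Even n) :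
    periodVector (linearCycleFunctional n d ζ a b hn) = linearCyclePeriod n d ζ a b := by
  funext i
  rw [periodVector, linearCycleFunctional_monomial ζ a b hn, one_mul, Finsupp.coe_equivFunOnFinite_symm]

/-- Every coordinate is paired: `x = b(2e)` or `x = b(2e+1)` for some `e`. [cite: MovasatiVillaflor2018, §1] -/
theorem exists_pair (hn : Even n) (x : Fin (n+2)) :
    ∃ e : Fin (n/2+1), x = b ⟨2*e, by omega⟩ ∨ x = b ⟨2*e+1, by omega⟩ := by
  obtain ⟨y, hy⟩ := ((pairEquiv n hn).trans b).surjective x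
  rcases y with e | e
  · exact ⟨e, Or.inl (by rw [← hy, Equiv.trans_apply, pairEquiv_inl])⟩
  · exact ⟨e, Or.inr (by rw [← hy, Equiv.trans_apply, pairEquiv_inr])⟩

/-- The periods vanish on the Jacobian ideal: `p_s = 0` as soon as some exponent `s_x ≥ d − 1` (`d ≥ 2`), since then
the pair containing `x` cannot sum to `d − 2` ("For any other `i` … `p_i` by definition is zero").
[cite: MovasatiVillaflor2018, Theorem 1, §5] -/
theorem linearCyclePeriod_eq_zero_of_le (hn : Even n) (hd : 2 ≤ d) {s : Fin (n+2) → ℕ}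
    (hs : ∃ x, d - 1 ≤ s x) :
    linearCyclePeriod n d ζ a b s = 0 := by
  obtain ⟨x, hx⟩ := hs
  obtain ⟨e, he⟩ := exists_pair b hn x
  rw [linearCyclePeriod, if_neg]
  intro h
  have := h e
  rcases he with rfl | rfl <;> omega

/-- The period functional kills the monomials of `J^F = (x_e^{d−1})` (`d ≥ 2`). [cite: MovasatiVillaflor2018, Theorem 1, §5] -/
theorem linearCycleFunctional_monomial_eq_zero_of_le (hn : Even n) (hd : 2 ≤ d) {s : Fin (n+2) →₀ ℕ}
    (hs : ∃ x, d - 1 ≤ s x) : linearCycleFunctional n d ζ a b hn (monomial s 1) = 0 := by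
  rw [linearCycleFunctional_monomial ζ a b hn, linearCyclePeriod_eq_zero_of_le ζ a b hn hd hs, mul_zero]

/-- The period functional is concentrated in the socle degree `σ = (n/2+1)(d−2)` of `J^{F,λ}`.
[cite: DuqueFrancoVillaflor2025Join, Definition 2.2, Remark 7.1] [cite: Villaflorloyola2021, Definition 2.1] -/
theorem linearCycleFunctional_homogeneousComponent (hn : Even n) (p : MvPolynomial (Fin (n+2)) K) :
    linearCycleFunctional n d ζ a b hn (homogeneousComponent ((n/2+1) * (d-2)) p) =
      linearCycleFunctional n d ζ a b hn p := by
  have h := fermatLinearCycleFunctional_homogeneousComponent (twist n ζ a) (d-1)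
    (rename ((pairEquiv n hn).trans b).symm p)
  rw [Fintype.card_fin, show d - 1 - 1 = d - 2 by omega, ← rename_homogeneousComponent] at h
  rw [linearCycleFunctional, LinearMap.smul_apply, LinearMap.smul_apply, LinearMap.comp_apply,
    LinearMap.comp_apply, AlgHom.toLinearMap_apply, AlgHom.toLinearMap_apply, h]

/-- Transporting DFV's ideal `⟨x_{2j} − c_j x_{2j+1}, x_i^{d−1}⟩` along the pairing of `ℙ_{a,b}` gives `linearCycleIdeal`.
[cite: DuqueFrancoVillaflor2025Join, Remark 7.1] -/
theorem map_rename_fermatLinearCycleIdeal (hn : Even n) :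
    (fermatLinearCycleIdeal (twist n ζ a) (d-1)).map
        (rename ((pairEquiv n hn).trans b) :
          MvPolynomial (Fin (n/2+1) ⊕ Fin (n/2+1)) K →ₐ[K] MvPolynomial (Fin (n+2)) K) =
      linearCycleIdeal n d ζ a b := by
  have h₁ : ((rename ((pairEquiv n hn).trans b) :
        MvPolynomial (Fin (n/2+1) ⊕ Fin (n/2+1)) K →ₐ[K] MvPolynomial (Fin (n+2)) K) ∘
        fun j : Fin (n/2+1) => (X (Sum.inl j) : MvPolynomial (Fin (n/2+1) ⊕ Fin (n/2+1)) K) -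
          C (twist n ζ a j) * X (Sum.inr j)) =
      fun e : Fin (n/2+1) =>
        (X (b ⟨2*e, by omega⟩) : MvPolynomial (Fin (n+2)) K) - C (twist n ζ a e) * X (b ⟨2*e+1, by omega⟩) :=
    funext fun e => by
      simp only [Function.comp_apply, map_sub, map_mul, rename_X, rename_C, Equiv.trans_apply, pairEquiv_inl,
        pairEquiv_inr]
  have h₂ : ((rename ((pairEquiv n hn).trans b) :
        MvPolynomial (Fin (n/2+1) ⊕ Fin (n/2+1)) K →ₐ[K] MvPolynomial (Fin (n+2)) K) ∘
        fun i : Fin (n/2+1) ⊕ Fin (n/2+1) => (X i : MvPolynomial (Fin (n/2+1) ⊕ Fin (n/2+1)) K) ^ (d - 1)) =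
      (fun i : Fin (n+2) => (X i : MvPolynomial (Fin (n+2)) K) ^ (d - 1)) ∘ ((pairEquiv n hn).trans b) :=
    funext fun i => by simp only [Function.comp_apply, map_pow, rename_X]
  rw [fermatLinearCycleIdeal, linearCycleIdeal, Ideal.map_span, Set.image_union, ← Set.range_comp,
    ← Set.range_comp, h₁, h₂, ((pairEquiv n hn).trans b).surjective.range_comp]

/-- **`Ann(ℓ_{a,b}) = J^{F,[ℙ_{a,b}]} = ⟨x_{b(2e)} − ζ^{1+2a_{2e+1}} x_{b(2e+1)}, x_i^{d−1}⟩`** (`ζ ≠ 0`, `d ≥ 2`): the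
Voisin–Otwinowska ideal of the linear cycle, DFV eq. (eqAGfakelcFermat) in the coordinates of `ℙ_{a,b}`.
[cite: DuqueFrancoVillaflor2025Join, Remark 7.1] [cite: Villaflorloyola2021, Definition 2.1, Proposition 4.1] -/
theorem annIdeal_linearCycleFunctional (hn : Even n) (hζ : ζ ≠ 0) (hd : 2 ≤ d) :
    annIdeal (linearCycleFunctional n d ζ a b hn) = linearCycleIdeal n d ζ a b := by
  have hc : ((Equiv.Perm.sign b : ℤ) : K) * ζ ^ (∑ e : Fin (n/2+1), (1 + 2 * a ⟨2*e+1, by omega⟩)) ≠ 0 := by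
    refine mul_ne_zero ?_ (pow_ne_zero _ hζ)
    rcases Int.units_eq_one_or (Equiv.Perm.sign b) with h | h <;> simp [h]
  rw [linearCycleFunctional, annIdeal_smul _ hc,
    annIdeal_comp_of_surjective _ (rename_surjective _ ((pairEquiv n hn).trans b).symm.surjective),
    annIdeal_fermatLinearCycleFunctional _ _ (by omega), ← map_rename_eq_comap_rename_symm,
    map_rename_fermatLinearCycleIdeal ζ a b hn]

/-- **`HF_{[ℙ_{a,b}]}(k) = ciHilbert [(d−1)^{n/2+1}] k`** — the Hilbert function of `K[y_0, …, y_{n/2}]/(y_j^{d−1})`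
("`HF_λ = HF_{[ℙ^{n/2}]}`"; Movasati's box count in half the variables; at `k = d`: `binom(n/2+d,d) − (n/2+1)²`).
[cite: DuqueFrancoVillaflor2025Join, Remark 7.1] [cite: Villaflorloyola2021, Proposition 4.1] -/
theorem hilbert_linearCycleIdeal (hn : Even n) (hd : 2 ≤ d) (k : ℕ) :
    finrank K (homogeneousSubmodule (Fin (n+2)) K k) - finrank K (idealDegree (linearCycleIdeal n d ζ a b) k) =
      Kloosterman2023.ciHilbert (List.replicate (n/2+1) (d-1)) k := by
  classical
  rw [← map_rename_fermatLinearCycleIdeal ζ a b hn, hilbert_map_rename_equiv,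
    hilbert_fermatLinearCycleIdeal_eq_card _ _ (by omega), ← List.ofFn_const]
  convert card_filter_finsuppAntidiag_eq_ciHilbert (fun _ : Fin (n/2+1) => d - 1) (fun _ => by omega) k using 3

/-! ## Theorem 2 of [Movasati2017GMCD] at the Fermat point: the rank of `[p_{i+j}(ℙ^{n/2})]` -/

/-- Degree bookkeeping: `d + ((n/2)d − n − 2) = (n/2+1)(d−2)` for `n = 2k`, `n + 2 ≤ k·d`. [folklore] -/
private theorem deg_add_rowDeg {k : ℕ} (hk : n = 2 * k) (hN : n + 2 ≤ k * d) :
    d + (k * d - n - 2) = (k + 1) * (d - 2) := by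
  subst hk
  obtain ⟨d', rfl⟩ : ∃ d', d = d' + 2 := ⟨d - 2, by
    by_contra h
    have : k * d ≤ k * 1 := Nat.mul_le_mul_left k (by omega)
    omega⟩
  have e1 : (k + 1) * (d' + 2 - 2) = k * d' + d' := by rw [Nat.add_sub_cancel]; ring
  have e2 : k * (d' + 2) = k * d' + 2 * k := by ring
  rw [e2] at hN
  rw [e1, e2]
  omega

/-- **`rank [p_{i+j}(c·ℙ^{n/2}_{a,b})] = binom(n/2+d, d) − (n/2+1)²`** for every even `n` with `n + 2 ≤ (n/2)·d`
(`d ≥ 2 + 4/n`), every `ζ ≠ 0`, all twists `a`, every permutation `b` and every coefficient `c ≠ 0` — the rank of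
Movasati's matrix `[x_{i+j}]` at the periods of a linear `ℙ^{n/2}` ("Such numbers are the periods of the projective space
`ℙ^{n/2}` inside the Fermat variety"), i.e. the codimension `binom(n/2+d,d) − (n/2+1)²` of the locus of hypersurfaces
containing a linear `ℙ^{n/2}` (Theorem 2; [Movasati2016Periods] Thm. 5 / eq. after Thm. 7), at the level of the
period matrix. [cite: Movasati2017GMCD, Theorem 2, §3.5] [cite: Movasati2016Periods, Theorem 5, Theorem 6]
[cite: MovasatiVillaflor2018, Theorem 1, Proposition 1] [cite: Villaflorloyola2021, Proposition 4.1] -/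
theorem rank_periodMatrix_linearCycle (hn : Even n) (hN : n + 2 ≤ n / 2 * d) {ζ : K} (hζ : ζ ≠ 0)
    (a : Fin (n+2) → ℕ) (b : Equiv.Perm (Fin (n+2))) {c : K} (hc : c ≠ 0) :
    (periodMatrix (n+2) d (n / 2 * d - n - 2) d (fun i => c * linearCyclePeriod n d ζ a b i)).rank =
      (n / 2 + d).choose d - (n / 2 + 1) ^ 2 := by
  have hk : n = 2 * (n / 2) := by obtain ⟨r, hr⟩ := hn; omega
  have hd : 3 ≤ d := by
    by_contra h
    have : n / 2 * d ≤ n / 2 * 2 := Nat.mul_le_mul_left _ (by omega)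
    omega
  rw [rank_periodMatrix_mul hc, ← periodVector_linearCycleFunctional ζ a b hn,
    rank_periodMatrix_eq_hilbert (linearCycleFunctional n d ζ a b hn)
      (fun s hs => linearCycleFunctional_monomial_eq_zero_of_le ζ a b hn (by omega) hs)
      (linearCycleFunctional_homogeneousComponent ζ a b hn) (deg_add_rowDeg hk hN),
    annIdeal_linearCycleFunctional ζ a b hn hζ (by omega), hilbert_linearCycleIdeal ζ a b hn (by omega),
    ← DuqueFrancoVillaflor2025.linearCycleHF_eq_ciHilbert]
  have h := DuqueFrancoVillaflor2025.linearCycleHF_self (n / 2) d hd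
  rw [Nat.choose_symm_add] at h
  omega

/-- The same with the raw period vector of Theorem 1 (coefficient `1`). [cite: Movasati2017GMCD, Theorem 2, §3.5]
[cite: MovasatiVillaflor2018, Theorem 1] -/
theorem rank_periodMatrix_linearCyclePeriod (hn : Even n) (hN : n + 2 ≤ n / 2 * d) {ζ : K} (hζ : ζ ≠ 0)
    (a : Fin (n+2) → ℕ) (b : Equiv.Perm (Fin (n+2))) :
    (periodMatrix (n+2) d (n / 2 * d - n - 2) d (linearCyclePeriod n d ζ a b)).rank =
      (n / 2 + d).choose d - (n / 2 + 1) ^ 2 := by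
  have h := rank_periodMatrix_linearCycle hn hN hζ a b one_ne_zero
  simpa only [one_mul] using h

/-- **`HF_{[ℙ_{a,b}]}(d) = binom(n/2+d, d) − (n/2+1)²`**: the Voisin–Otwinowska ideal of a linear cycle has codimension
`binom(n/2+d,d) − (n/2+1)²` in degree `d` (`d ≥ 3`; Villaflor's equality case of (des1), DFV Rem. 7.1's "which in
turn implies that `HF_λ = HF_{[ℙ^{n/2}]}`"). [cite: Villaflorloyola2021, Proposition 4.1]
[cite: DuqueFrancoVillaflor2025Join, Remark 7.1] [cite: Movasati2017GMCD, Theorem 2] -/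
theorem hilbert_linearCycleIdeal_self (hn : Even n) (hd : 3 ≤ d) :
    finrank K (homogeneousSubmodule (Fin (n+2)) K d) - finrank K (idealDegree (linearCycleIdeal n d ζ a b) d) =
      (n / 2 + d).choose d - (n / 2 + 1) ^ 2 := by
  rw [hilbert_linearCycleIdeal ζ a b hn (by omega), ← DuqueFrancoVillaflor2025.linearCycleHF_eq_ciHilbert]
  have h := DuqueFrancoVillaflor2025.linearCycleHF_self (n / 2) d hd
  rw [Nat.choose_symm_add] at h
  omega

/-! ## Combinations of linear cycles: `rank [p_{i+j}(Σ c_k ℙ_k)] = HF_{Ann(Σ c_k ℓ_k)}(d)` -/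

/-- The period vector of a `K`-linear combination `δ = Σ_k c_k [ℙ^{n/2}_{a_k,b_k}]` of linear cycles:
`p_i(δ) = Σ_k c_k p_i(ℙ_{a_k,b_k})` (MV18 §5: `ρ_i := ∫_ℙ ω_i + ∫_ℙ̌ ω_i`; the census schema's `periodComb`).
[cite: MovasatiVillaflor2018, §5] [cite: Movasati2016Periods, Definition 1] -/
def combPeriod (n d : ℕ) (ζ : K) (δ : List (K × (Fin (n+2) → ℕ) × Equiv.Perm (Fin (n+2))))
    (i : Fin (n+2) → ℕ) : K :=
  (δ.map fun x => x.1 * linearCyclePeriod n d ζ x.2.1 x.2.2 i).sum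

/-- The period functional of `δ = Σ_k c_k [ℙ_{a_k,b_k}]`: `Σ_k c_k ℓ_{a_k,b_k}`; its graded annihilator is Villaflor's
`J^{F,δ}` (Def. 2.1). [cite: MovasatiVillaflor2018, §5, §6] [cite: Villaflorloyola2021, Definition 2.1] -/
def combFunctional (n d : ℕ) (ζ : K) (hn : Even n) :
    List (K × (Fin (n+2) → ℕ) × Equiv.Perm (Fin (n+2))) → (MvPolynomial (Fin (n+2)) K →ₗ[K] K)
  | [] => 0
  | x :: δ => x.1 • linearCycleFunctional n d ζ x.2.1 x.2.2 hn + combFunctional n d ζ hn δ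

/-- `p_i(Σ c_k ℙ_k) = 0` on the monomials of `J^F` (`d ≥ 2`). [cite: MovasatiVillaflor2018, Theorem 1, §5] -/
theorem combPeriod_eq_zero_of_le (hn : Even n) (hd : 2 ≤ d)
    (δ : List (K × (Fin (n+2) → ℕ) × Equiv.Perm (Fin (n+2)))) {s : Fin (n+2) → ℕ} (hs : ∃ x, d - 1 ≤ s x) :
    combPeriod n d ζ δ s = 0 := by
  induction δ with
  | nil => rfl
  | cons x δ ih =>
    rw [combPeriod, List.map_cons, List.sum_cons, linearCyclePeriod_eq_zero_of_le ζ x.2.1 x.2.2 hn hd hs, mul_zero,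
      zero_add]
    exact ih

/-- **The values of `Σ c_k ℓ_k` on monomials are the periods `p_s(δ)`**. [cite: MovasatiVillaflor2018, Theorem 1, §5] -/
theorem combFunctional_monomial (hn : Even n) (δ : List (K × (Fin (n+2) → ℕ) × Equiv.Perm (Fin (n+2))))
    (s : Fin (n+2) →₀ ℕ) (r : K) :
    combFunctional n d ζ hn δ (monomial s r) = r * combPeriod n d ζ δ ⇑s := by
  induction δ with
  | nil => simp [combFunctional, combPeriod]
  | cons x δ ih =>
    rw [combFunctional, LinearMap.add_apply, LinearMap.smul_apply, linearCycleFunctional_monomial ζ _ _ hn, ih,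
      combPeriod, combPeriod, List.map_cons, List.sum_cons, smul_eq_mul]
    ring

/-- `Σ c_k ℓ_k` is concentrated in degree `σ = (n/2+1)(d−2)`. [cite: Villaflorloyola2021, Definition 2.1] -/
theorem combFunctional_homogeneousComponent (hn : Even n)
    (δ : List (K × (Fin (n+2) → ℕ) × Equiv.Perm (Fin (n+2)))) (p : MvPolynomial (Fin (n+2)) K) :
    combFunctional n d ζ hn δ (homogeneousComponent ((n/2+1) * (d-2)) p) = combFunctional n d ζ hn δ p := by
  induction δ with
  | nil => rfl
  | cons x δ ih =>
    rw [combFunctional, LinearMap.add_apply, LinearMap.add_apply, LinearMap.smul_apply, LinearMap.smul_apply,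
      linearCycleFunctional_homogeneousComponent ζ _ _ hn, ih]

/-- **`rank [p_{i+j}(Σ_k c_k ℙ_{a_k,b_k})] = dim_K S_d − dim_K (Ann(Σ_k c_k ℓ_{a_k,b_k}))_d = HF_{J^{F,δ}}(d)`** for every
`K`-linear combination of linear cycles of the Fermat variety (`n` even, `n + 2 ≤ (n/2)d`): the rank certified by the
census for a row `δ` IS the degree-`d` value of the Hilbert function of the Voisin–Otwinowska ideal of `δ` (MV18 §6:
"Knowing that `ker [ρ_{i+j}]` is the Zariski tangent space of the analytic scheme `V_{[Z_0]}` …"; Villaflor Def. 2.1 /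
Prop. 2.1) — the transcendental identification with `T_0V_δ` is NOT formalised. [cite: MovasatiVillaflor2018, §5, §6]
[cite: Movasati2016Periods, Theorem 6] [cite: Villaflorloyola2021, Definition 2.1, Proposition 2.1] -/
theorem rank_periodMatrix_comb (hn : Even n) (hN : n + 2 ≤ n / 2 * d)
    (δ : List (K × (Fin (n+2) → ℕ) × Equiv.Perm (Fin (n+2)))) :
    (periodMatrix (n+2) d (n / 2 * d - n - 2) d (combPeriod n d ζ δ)).rank =
      finrank K (homogeneousSubmodule (Fin (n+2)) K d) -
        finrank K (idealDegree (annIdeal (combFunctional n d ζ hn δ)) d) := by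
  have hk : n = 2 * (n / 2) := by obtain ⟨r, hr⟩ := hn; omega
  have hd : 2 ≤ d := by
    by_contra h
    have : n / 2 * d ≤ n / 2 * 2 := Nat.mul_le_mul_left _ (by omega)
    omega
  refine rank_periodMatrix_eq_hilbert_of_eq (combFunctional n d ζ hn δ) (fun s hs => ?_)
    (combFunctional_homogeneousComponent ζ hn δ) (deg_add_rowDeg hk hN) fun i => ?_
  · rw [combFunctional_monomial ζ hn, combPeriod_eq_zero_of_le ζ hn hd δ hs, mul_zero]
  · rw [combFunctional_monomial ζ hn, one_mul, Finsupp.coe_equivFunOnFinite_symm]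

end Literature.AlgebraicGeometry.MovasatiVillaflor2018

end
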